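import Summits.AtomisticToContinuum.Crystallization.Theorems.SlackRigidity.Negative.WitnessBasics
import Summits.AtomisticToContinuum.Crystallization.Theorems.ThreeConeCertificateSlackRigidityThinning
import Summits.AtomisticToContinuum.Crystallization.Theorems.ThreeConeCertificateSlackRigidityRooting
import Summits.AtomisticToContinuum.Crystallization.Theorems.ChargedEnergyGap.Negative.Unconditional
import Summits.AtomisticToContinuum.Crystallization.Theorems.PalmUnimodularRigidityBenjaminiSchrammLimit
import Summits.AtomisticToContinuum.Crystallization.Theorems.ThreeConeCertificateSlackRigidityBSLimit
import Literature.Probability.Process.PointStationaryLaw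
import HarnessLib

/-!
# Crux `SlackRigidity` (stmt-AtomisticToContinuum-11960), line `ekeland-surgery-parity`:
# the PALM REDUCTION `PalmRigidity (9224) ∧ HcpOptimalCongruent ⇒ SlackRigidity`, kernel-checked

Route `ThreeConeCertificate`, sub-problem `Crystallization`.  This file lands the composition of the
(reshaped) line `ekeland-surgery-parity` as a CONDITIONAL theorem: the crux
`ThreeConeCertificate.SlackRigidity` (o(N)-excess Lennard-Jones sequences are locally hcp at all but
o(N) particles) follows from

* `PalmRigidity` — VERBATIM the open target stmt-AtomisticToContinuum-9224 of route
  `PalmUnimodularRigidity` (a minimising point-stationary hard-core law on rooted configurations of `ℝ³`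
  is a.s. a rotated relaxed hcp crystal with optimal box parameters), and
* `HcpOptimalCongruent` — two box-minimisers of `(a,h) ↦ e(hcp(a,h))` on `[1/2,2]²` give congruent
  stackings (uniqueness of the relaxed-hcp optimum up to congruence; a certified-numerics statement, and a
  NECESSARY condition of the crux by `SlackRigidityNegative.rigidFor_unique_up_to_isometry`).

Everything else is landed: `1/3`-thinning paid out of the excess (`CLayerWitnessThinning.stub_thinning`,
`CLayerWitnessRooting.badCount_le_badCount_thinned`), the Benjamini–Schramm limit of a separated family
(`EkelandSurgeryParityBSLimit.stub_bsLimit`), `E(N)/N → ⨅_Q e(Q)` (`ChargedEnergyGapNegative.crysEnergyLimit`)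
and `BddBelow` of the periodic energies (`bddBelow_energyPerParticle_lennardJones`), the Benjamini–Schramm
limit of the ground states (`benjaminiSchrammLimit_proof`, used to produce optimal parameters).

Mechanism: along an injective `o(N)`-excess sequence with `(R, ε)`-bad fraction `≥ θ` frequently, thin,
root uniformly and pass to the local weak limit: the limit law is point-stationary, `1/3`-hard-core and
EXACTLY minimising (`E_P[h] = lim 𝓔/N = ⨅_Q e(Q)`), so `PalmRigidity` makes it a.s. a rotated optimal
hcp, `HcpOptimalCongruent` makes it a.s. a rotated copy of ONE template `hcp(a₀,h₀)`, and the portmanteau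
density transfer makes eventually all but `θ/4` of the thinned particles `(R, ε)`-good — contradiction.
So the crux is reduced, in the tree, to the existing item 9224 plus one computation. [folklore]
-/

noncomputable section

open scoped BigOperators Topology ENNReal
open MeasureTheory Filter Set Metric

namespace Summit.AtomisticToContinuum.Crystallization.Theorems.EkelandSurgeryParityReduction

open Literature.MathematicalPhysics.StatisticalMechanics
open Literature.Probability.Process
open Summit.AtomisticToContinuum.Crystallization.Theses.ThreeConeCertificate (SlackRigidity)
open Summit.AtomisticToContinuum.Crystallization.Theses.PalmUnimodularRigidity (PalmRigidity)
open Summit.AtomisticToContinuum.Crystallization.Theorems.SlackRigidityNegative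
  (E3 Good badCount BadFractionVanishes ExcessVanishes RigidFor slackRigidity_iff gs gs_isGroundState)
open Summit.AtomisticToContinuum.Crystallization.Theorems.ChargedEnergyGapNegative
  (eStar crysEnergyLimit bddBelow_energyPerParticle_lennardJones eStar_le card_mul_eStar_le)

/-! ## Glue -/

/-- Optimal box parameters exist, GIVEN Palm rigidity: apply it to the Benjamini–Schramm limit of the
ground states (landed item 9230 `benjaminiSchrammLimit_proof`), whose mean root energy is
`lim E(N)/N = ⨅_Q e(Q)` (landed item 0626). [folklore] -/
theorem exists_optimal_of_palmRigidity
    (hPalm : ∀ δ : ℝ, 0 < δ → ∀ P : Measure (Measure E3), IsProbabilityMeasure P →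
      (∀ᵐ μ ∂P, (∃ S : Set E3, (0 : E3) ∈ S ∧ (∀ x ∈ S, ∀ y ∈ S, x ≠ y → δ ≤ dist x y) ∧
        μ = (Measure.count : Measure E3).restrict S)) →
      (∀ g : Measure E3 → E3 → ℝ≥0∞, Measurable (Function.uncurry g) →
        ∫⁻ μ, ∫⁻ y, g μ y ∂μ ∂P = ∫⁻ μ, ∫⁻ y, g (Measure.map (fun z => z - y) μ) (-y) ∂μ ∂P) →
      (∫ μ, (∫ y, lennardJones ‖y‖ ∂μ) / 2 ∂P) ≤
        (⨅ Q : PeriodicConfiguration 3, Q.energyPerParticle lennardJones) →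
      ∀ᵐ μ ∂P, (∃ a h : ℝ, ∃ ha : a ≠ 0, ∃ hh : h ≠ 0, 1 / 2 ≤ a ∧ a ≤ 2 ∧ 1 / 2 ≤ h ∧ h ≤ 2 ∧
        ∃ A : E3 ≃ₗᵢ[ℝ] E3,
          (hcpPeriodicConfiguration ha hh).energyPerParticle lennardJones =
            (⨅ Q : PeriodicConfiguration 3, Q.energyPerParticle lennardJones) ∧
          μ = (Measure.count : Measure E3).restrict (A '' hcpStacking a h))) :
    ∃ a h : ℝ, ∃ ha : a ≠ 0, ∃ hh : h ≠ 0, 1 / 2 ≤ a ∧ a ≤ 2 ∧ 1 / 2 ≤ h ∧ h ≤ 2 ∧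
      (hcpPeriodicConfiguration ha hh).energyPerParticle lennardJones =
        (⨅ Q : PeriodicConfiguration 3, Q.energyPerParticle lennardJones) := by
  obtain ⟨φ, hφ, δ, hδ, P, hP, hcore, hstat, hE, -⟩ :=
    Summit.AtomisticToContinuum.Crystallization.Theorems.benjaminiSchrammLimit_proof gs gs_isGroundState
  haveI := hP
  have hlim : Tendsto (fun j : ℕ => groundStateEnergy lennardJones 3 (φ j) / (φ j : ℝ)) atTop
      (𝓝 (⨅ Q : PeriodicConfiguration 3, Q.energyPerParticle lennardJones)) :=
    crysEnergyLimit.comp hφ.tendsto_atTop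
  have hEq := tendsto_nhds_unique hE hlim
  have hae := hPalm δ hδ P hP hcore hstat hEq.le
  obtain ⟨μ, a, h, ha, hh, h1, h2, h3, h4, A, hopt, -⟩ := hae.exists
  exact ⟨a, h, ha, hh, h1, h2, h3, h4, hopt⟩

/-- Matching transferred from a rotated copy of the template gives `Good`. [folklore] -/
theorem good_of_matched {P₀ : PeriodicConfiguration 3} {R ε : ℝ} {N : ℕ} {x : Fin N → E3} {i : Fin N}
    (C : E3 →ₗᵢ[ℝ] E3)
    (h1 : ∀ p : E3, (Measure.count : Measure E3).restrict (C '' P₀.points) {p} ≠ 0 → ‖p‖ ≤ R →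
      ∃ q ∈ (Set.range (fun k : Fin N => x k - x i)), dist q p ≤ ε)
    (h2 : ∀ q ∈ (Set.range (fun k : Fin N => x k - x i)), ‖q‖ ≤ R →
      ∃ p : E3, (Measure.count : Measure E3).restrict (C '' P₀.points) {p} ≠ 0 ∧ dist q p ≤ ε) :
    Good P₀ R ε x i := by
  refine ⟨C, ?_, ?_⟩
  · intro p hp hpR
    have hmem : C p ∈ C '' P₀.points := ⟨p, hp, rfl⟩
    have hnorm : ‖C p‖ ≤ R := by rwa [LinearIsometry.norm_map]
    obtain ⟨q, ⟨k, rfl⟩, hq⟩ := h1 (C p) ((count_restrict_singleton_ne_zero_iff _ _).2 hmem) hnorm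
    refine ⟨k, ?_⟩
    rw [dist_eq_norm] at hq ⊢
    rwa [← sub_sub]
  · intro j hj
    have hq : x j - x i ∈ Set.range (fun k : Fin N => x k - x i) := ⟨j, rfl⟩
    have hqn : ‖x j - x i‖ ≤ R := by rwa [← dist_eq_norm]
    obtain ⟨p, hp, hd⟩ := h2 _ hq hqn
    obtain ⟨p₀, hp₀, rfl⟩ := (count_restrict_singleton_ne_zero_iff _ _).1 hp
    refine ⟨p₀, hp₀, ?_⟩
    rw [dist_eq_norm] at hd ⊢
    rwa [← sub_sub]

/-- Counting: `#good + #bad = N`. [folklore] -/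
theorem natCard_good_add_badCount (P : PeriodicConfiguration 3) (R ε : ℝ) {N : ℕ} (x : Fin N → E3) :
    (Nat.card {i : Fin N // Good P R ε x i} : ℝ) + badCount P R ε x = N := by
  classical
  unfold badCount
  rw [Nat.card_eq_fintype_card, Nat.card_eq_fintype_card, Fintype.card_subtype_compl,
    Fintype.card_fin]
  have : Fintype.card {i : Fin N // Good P R ε x i} ≤ N := by
    simpa using Fintype.card_subtype_le (fun i : Fin N => Good P R ε x i)
  push_cast [Nat.cast_sub this]
  ring

/-! ## The composition (sorry-free; `PalmRigidity` and `HcpOptimalCongruent` enter as hypotheses) -/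

/-- **Core of the composition.**  For optimal box parameters `(a₀, h₀)`, the crux's conclusion holds
for the witness `hcpPeriodicConfiguration a₀ h₀`: thinning (landed) → Benjamini–Schramm limit of the
rooted thinned bad subsequence (`stub_bsLimit`) → the limit law is exactly minimising (landed
`crysEnergyLimit`) → a.s. a rotated optimal hcp (`stub_palmRigidity`) → a.s. a rotated `hcp(a₀,h₀)`
(`stub_hcpOptimalCongruent`) → density transfer → too few bad particles. [folklore] -/
theorem rigidFor_hcp_of_optimal
    (hPalm : (∀ δ : ℝ, 0 < δ → ∀ P : Measure (Measure E3), IsProbabilityMeasure P →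
      (∀ᵐ μ ∂P, (∃ S : Set E3, (0 : E3) ∈ S ∧ (∀ x ∈ S, ∀ y ∈ S, x ≠ y → δ ≤ dist x y) ∧
        μ = (Measure.count : Measure E3).restrict S)) →
      (∀ g : Measure E3 → E3 → ℝ≥0∞, Measurable (Function.uncurry g) →
        ∫⁻ μ, ∫⁻ y, g μ y ∂μ ∂P = ∫⁻ μ, ∫⁻ y, g (Measure.map (fun z => z - y) μ) (-y) ∂μ ∂P) →
      (∫ μ, (∫ y, lennardJones ‖y‖ ∂μ) / 2 ∂P) ≤
        (⨅ Q : PeriodicConfiguration 3, Q.energyPerParticle lennardJones) →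
      ∀ᵐ μ ∂P, (∃ a h : ℝ, ∃ ha : a ≠ 0, ∃ hh : h ≠ 0, 1 / 2 ≤ a ∧ a ≤ 2 ∧ 1 / 2 ≤ h ∧ h ≤ 2 ∧
        ∃ A : E3 ≃ₗᵢ[ℝ] E3,
          (hcpPeriodicConfiguration ha hh).energyPerParticle lennardJones =
            (⨅ Q : PeriodicConfiguration 3, Q.energyPerParticle lennardJones) ∧
          μ = (Measure.count : Measure E3).restrict (A '' hcpStacking a h))))
    (hUniq : (∀ (a h a' h' : ℝ) (ha : a ≠ 0) (hh : h ≠ 0) (ha' : a' ≠ 0) (hh' : h' ≠ 0),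
      1 / 2 ≤ a → a ≤ 2 → 1 / 2 ≤ h → h ≤ 2 → 1 / 2 ≤ a' → a' ≤ 2 → 1 / 2 ≤ h' → h' ≤ 2 →
      (∀ (b k : ℝ) (hb : b ≠ 0) (hk : k ≠ 0), 1 / 2 ≤ b → b ≤ 2 → 1 / 2 ≤ k → k ≤ 2 →
        (hcpPeriodicConfiguration ha hh).energyPerParticle lennardJones ≤
          (hcpPeriodicConfiguration hb hk).energyPerParticle lennardJones) →
      (∀ (b k : ℝ) (hb : b ≠ 0) (hk : k ≠ 0), 1 / 2 ≤ b → b ≤ 2 → 1 / 2 ≤ k → k ≤ 2 →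
        (hcpPeriodicConfiguration ha' hh').energyPerParticle lennardJones ≤
          (hcpPeriodicConfiguration hb hk).energyPerParticle lennardJones) →
      ∃ B : E3 →ₗᵢ[ℝ] E3, hcpStacking a' h' = B '' hcpStacking a h))
    {a₀ h₀ : ℝ} (ha₀ : a₀ ≠ 0) (hh₀ : h₀ ≠ 0)
    (hbox : 1 / 2 ≤ a₀ ∧ a₀ ≤ 2 ∧ 1 / 2 ≤ h₀ ∧ h₀ ≤ 2)
    (hopt : (hcpPeriodicConfiguration ha₀ hh₀).energyPerParticle lennardJones =
      (⨅ Q : PeriodicConfiguration 3, Q.energyPerParticle lennardJones)) :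
    RigidFor (hcpPeriodicConfiguration ha₀ hh₀) := by
  classical
  intro R ε hR hε x hx hexc
  unfold BadFractionVanishes
  by_contra hnot
  obtain ⟨θ, hθ, hfreq⟩ :=
    Summit.AtomisticToContinuum.Crystallization.Theorems.CLayerWitnessRooting.exists_frequently_le_of_not_tendsto
      (fun N => by positivity) hnot
  -- Step 1: `1/3`-thinning of every `x N` (landed `stub_thinning`), deletions paid out of the excess
  obtain ⟨K, hK, hthin⟩ :=
    Summit.AtomisticToContinuum.Crystallization.Theorems.CLayerWitnessThinning.stub_thinning
  have hthin' : ∀ N, ∃ (M : ℕ) (y : Fin M → E3), Function.Injective y ∧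
      Set.range y ⊆ Set.range (x N) ∧ (∀ i j : Fin M, i ≠ j → (1 / 3 : ℝ) ≤ dist (y i) (y j)) ∧
      M ≤ N ∧ K * ((N : ℝ) - M) ≤ interactionEnergy lennardJones (x N) -
        groundStateEnergy lennardJones 3 N ∧
      interactionEnergy lennardJones y ≤ interactionEnergy lennardJones (x N) :=
    fun N => hthin N (x N) (hx N)
  choose M y hyinj hysub hysep hMle hKM hEy using hthin'
  have hexc' : Tendsto (fun N : ℕ => (interactionEnergy lennardJones (x N) -
      groundStateEnergy lennardJones 3 N) / N) atTop (𝓝 0) := hexc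
  -- the deleted fraction `(N - M N)/N → 0`, hence `M N / N → 1`, `N / M N → 1`, `M N ≥ 1` eventually
  have hdel : Tendsto (fun N : ℕ => ((N : ℝ) - M N) / N) atTop (𝓝 0) := by
    have hup : Tendsto (fun N : ℕ => (interactionEnergy lennardJones (x N) -
        groundStateEnergy lennardJones 3 N) / N / K) atTop (𝓝 0) := by
      simpa using hexc'.div_const K
    refine tendsto_of_tendsto_of_tendsto_of_le_of_le tendsto_const_nhds hup (fun N => ?_)
      (fun N => ?_)
    · have : (M N : ℝ) ≤ N := by exact_mod_cast hMle N
      exact div_nonneg (by linarith) (Nat.cast_nonneg N)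
    · have hNK : ((N : ℝ) - M N) ≤ (interactionEnergy lennardJones (x N) -
          groundStateEnergy lennardJones 3 N) / K := by
        rw [le_div_iff₀ hK]; linarith [hKM N]
      calc ((N : ℝ) - M N) / N ≤ ((interactionEnergy lennardJones (x N) -
            groundStateEnergy lennardJones 3 N) / K) / N :=
            div_le_div_of_nonneg_right hNK (Nat.cast_nonneg N)
        _ = _ := by rw [div_right_comm]
  have hMN : Tendsto (fun N : ℕ => (M N : ℝ) / N) atTop (𝓝 1) := by
    have h1 : Tendsto (fun N : ℕ => 1 - ((N : ℝ) - M N) / N) atTop (𝓝 (1 - 0)) :=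
      tendsto_const_nhds.sub hdel
    rw [sub_zero] at h1
    refine h1.congr' ?_
    filter_upwards [eventually_gt_atTop 0] with N hN
    have hN' : (N : ℝ) ≠ 0 := by exact_mod_cast hN.ne'
    field_simp
    ring
  have hNM : Tendsto (fun N : ℕ => (N : ℝ) / M N) atTop (𝓝 1) := by
    have h1 := hMN.inv₀ one_ne_zero
    rw [inv_one] at h1
    refine h1.congr' (Eventually.of_forall fun N => ?_)
    simp only [inv_div]
  have hMpos : ∀ᶠ N in atTop, 1 ≤ M N := by
    have h1 : ∀ᶠ N in atTop, (1 / 2 : ℝ) < (M N : ℝ) / N :=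
      hMN.eventually (lt_mem_nhds (by norm_num))
    filter_upwards [h1] with N hN
    by_contra hM
    have hM0 : M N = 0 := by omega
    rw [hM0, Nat.cast_zero, zero_div] at hN
    norm_num at hN
  -- Step 2: a subsequence `ψ` with bad fraction `≥ θ`, `M ≥ 1`, `N ≥ 1`
  obtain ⟨ψ, hψ, hψP⟩ := extraction_of_frequently_atTop
    (hfreq.and_eventually (hMpos.and (eventually_gt_atTop 0)))
  -- Step 3: Benjamini–Schramm limit of the rooted thinned configurations along `ψ`
  obtain ⟨φ, hφ, P, hP, hcore, hstat, hEn, htr⟩ :=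
    EkelandSurgeryParityBSLimit.stub_bsLimit (1 / 3) (by norm_num) (fun k => M (ψ k)) (fun k => y (ψ k))
      (fun k => (hψP k).2.1) (fun k i j hij => hysep (ψ k) i j hij)
  haveI := hP
  -- Step 4: the limit law is exactly minimising, `E_P[h] ≤ e_∞ = ⨅_Q e(Q)` (landed `crysEnergyLimit`)
  have hsub : Tendsto (fun j => ψ (φ j)) atTop atTop := (hψ.comp hφ).tendsto_atTop
  have hv : Tendsto (fun j : ℕ => (groundStateEnergy lennardJones 3 (ψ (φ j)) / (ψ (φ j) : ℝ) +
      (interactionEnergy lennardJones (x (ψ (φ j))) -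
        groundStateEnergy lennardJones 3 (ψ (φ j))) / (ψ (φ j) : ℝ)) *
      ((ψ (φ j) : ℝ) / M (ψ (φ j)))) atTop
      (𝓝 (((⨅ Q : PeriodicConfiguration 3, Q.energyPerParticle lennardJones) + 0) * 1)) :=
    ((crysEnergyLimit.comp hsub).add (hexc'.comp hsub)).mul (hNM.comp hsub)
  rw [add_zero, mul_one] at hv
  have hElim : (∫ μ, (∫ y, lennardJones ‖y‖ ∂μ) / 2 ∂P) ≤
      (⨅ Q : PeriodicConfiguration 3, Q.energyPerParticle lennardJones) := by
    refine le_of_tendsto_of_tendsto' hEn hv fun j => ?_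
    have hN : (0 : ℝ) < ψ (φ j) := by exact_mod_cast (hψP (φ j)).2.2
    have hM : (0 : ℝ) < M (ψ (φ j)) := by
      have := (hψP (φ j)).2.1
      exact_mod_cast this
    have hE := hEy (ψ (φ j))
    have hre : (groundStateEnergy lennardJones 3 (ψ (φ j)) / (ψ (φ j) : ℝ) +
        (interactionEnergy lennardJones (x (ψ (φ j))) -
          groundStateEnergy lennardJones 3 (ψ (φ j))) / (ψ (φ j) : ℝ)) *
        ((ψ (φ j) : ℝ) / M (ψ (φ j))) =
        interactionEnergy lennardJones (x (ψ (φ j))) / M (ψ (φ j)) := by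
      field_simp
      ring
    rw [hre]
    exact div_le_div_of_nonneg_right hE hM.le
  -- Step 5: Palm rigidity — a.s. the limit is a rotated optimal relaxed hcp …
  have hae := hPalm (1 / 3) (by norm_num) P hP hcore hstat hElim
  -- … and by uniqueness of the optimum a rotated copy of the template `P₀ = hcp(a₀, h₀)`
  have hmin₀ : ∀ (b k : ℝ) (hb : b ≠ 0) (hk : k ≠ 0), 1 / 2 ≤ b → b ≤ 2 → 1 / 2 ≤ k → k ≤ 2 →
      (hcpPeriodicConfiguration ha₀ hh₀).energyPerParticle lennardJones ≤
        (hcpPeriodicConfiguration hb hk).energyPerParticle lennardJones := by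
    intro b k hb hk _ _ _ _
    rw [hopt]
    exact ciInf_le bddBelow_energyPerParticle_lennardJones _
  set T : Set (Measure E3) := {ν | ∃ C : E3 →ₗᵢ[ℝ] E3,
    ν = (Measure.count : Measure E3).restrict (C '' (hcpPeriodicConfiguration ha₀ hh₀).points)}
    with hT
  have haeT : ∀ᵐ μ ∂P, μ ∈ T := by
    filter_upwards [hae] with μ hμ
    obtain ⟨a, h, ha, hh, h1, h2, h3, h4, A, hopt', rfl⟩ := hμ
    have hmin : ∀ (b k : ℝ) (hb : b ≠ 0) (hk : k ≠ 0), 1 / 2 ≤ b → b ≤ 2 → 1 / 2 ≤ k → k ≤ 2 →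
        (hcpPeriodicConfiguration ha hh).energyPerParticle lennardJones ≤
          (hcpPeriodicConfiguration hb hk).energyPerParticle lennardJones := by
      intro b k hb hk _ _ _ _
      rw [hopt']
      exact ciInf_le bddBelow_energyPerParticle_lennardJones _
    obtain ⟨B, hB⟩ := hUniq a₀ h₀ a h ha₀ hh₀ ha hh hbox.1 hbox.2.1 hbox.2.2.1
      hbox.2.2.2 h1 h2 h3 h4 hmin₀ hmin
    refine ⟨A.toLinearIsometry.comp B, ?_⟩
    rw [hB, ← Set.image_comp, LinearIsometry.coe_comp, LinearIsometryEquiv.coe_toLinearIsometry,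
      hcpPeriodicConfiguration_points]
  have hTc : P Tᶜ = 0 := by
    rw [Set.compl_def]
    exact ae_iff.1 haeT
  have hPT : P T = 1 := by
    refine le_antisymm prob_le_one ?_
    calc (1 : ℝ≥0∞) = P Set.univ := measure_univ.symm
      _ = P (T ∪ Tᶜ) := by rw [Set.union_compl_self]
      _ ≤ P T + P Tᶜ := measure_union_le T Tᶜ
      _ = P T := by rw [hTc, add_zero]
  -- Step 6: density transfer back to the thinned configurations
  have hρ : 1 - θ / 4 < (P T).toReal := by
    rw [hPT, ENNReal.toReal_one]
    linarith
  have hev := htr T R ε hε (1 - θ / 4) hρ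
  have himp : ∀ (j : ℕ) (i : Fin (M (ψ (φ j)))),
      (∃ ν ∈ T, ((∀ p : E3, ν {p} ≠ 0 → ‖p‖ ≤ R →
          ∃ q ∈ (Set.range (fun k : Fin (M (ψ (φ j))) => y (ψ (φ j)) k - y (ψ (φ j)) i)),
            dist q p ≤ ε) ∧
        (∀ q ∈ (Set.range (fun k : Fin (M (ψ (φ j))) => y (ψ (φ j)) k - y (ψ (φ j)) i)),
          ‖q‖ ≤ R → ∃ p : E3, ν {p} ≠ 0 ∧ dist q p ≤ ε))) →
      Good (hcpPeriodicConfiguration ha₀ hh₀) R ε (y (ψ (φ j))) i := by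
    rintro j i ⟨ν, ⟨C, rfl⟩, hm1, hm2⟩
    exact good_of_matched C hm1 hm2
  have hgoodcard : ∀ j : ℕ, (Nat.card {i : Fin (M (ψ (φ j))) // ∃ ν ∈ T,
      ((∀ p : E3, ν {p} ≠ 0 → ‖p‖ ≤ R →
          ∃ q ∈ (Set.range (fun k : Fin (M (ψ (φ j))) => y (ψ (φ j)) k - y (ψ (φ j)) i)),
            dist q p ≤ ε) ∧
        (∀ q ∈ (Set.range (fun k : Fin (M (ψ (φ j))) => y (ψ (φ j)) k - y (ψ (φ j)) i)),
          ‖q‖ ≤ R → ∃ p : E3, ν {p} ≠ 0 ∧ dist q p ≤ ε))} : ℝ) ≤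
      Nat.card {i : Fin (M (ψ (φ j))) // Good (hcpPeriodicConfiguration ha₀ hh₀) R ε
        (y (ψ (φ j))) i} := fun j => by
    exact_mod_cast Nat.card_le_card_of_injective _
      (Subtype.map_injective (fun i hi => himp j i hi) Function.injective_id)
  -- the deletions spoil only `o(N)` environments
  have h4 : ∀ᶠ j : ℕ in atTop,
      ((ψ (φ j) : ℝ) - M (ψ (φ j))) / (ψ (φ j) : ℝ) * (1 + (6 * R + 1) ^ 3) < θ / 2 := by
    have h0 : Tendsto (fun j : ℕ => ((ψ (φ j) : ℝ) - M (ψ (φ j))) / (ψ (φ j) : ℝ) *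
        (1 + (6 * R + 1) ^ 3)) atTop (𝓝 0) := by
      simpa using (hdel.comp hsub).mul_const (1 + (6 * R + 1) ^ 3)
    exact h0.eventually (gt_mem_nhds (half_pos hθ))
  obtain ⟨j, hj3, hj4⟩ := (hev.and h4).exists
  -- Step 7: counting at `N = ψ (φ j)`
  have hθj := (hψP (φ j)).1
  have hN : (0 : ℝ) < ψ (φ j) := by exact_mod_cast (hψP (φ j)).2.2
  have hMleN : (M (ψ (φ j)) : ℝ) ≤ ψ (φ j) := by exact_mod_cast hMle (ψ (φ j))
  have hii : (badCount (hcpPeriodicConfiguration ha₀ hh₀) R ε (x (ψ (φ j))) : ℝ) ≤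
      badCount (hcpPeriodicConfiguration ha₀ hh₀) R ε (y (ψ (φ j))) +
        ((ψ (φ j) : ℝ) - M (ψ (φ j))) * (1 + (6 * R + 1) ^ 3) :=
    Summit.AtomisticToContinuum.Crystallization.Theorems.CLayerWitnessRooting.badCount_le_badCount_thinned
      (hcpPeriodicConfiguration ha₀ hh₀) R ε (hx _) (hysep _) (hysub _) hR.le
  have hsum := natCard_good_add_badCount (hcpPeriodicConfiguration ha₀ hh₀) R ε (y (ψ (φ j)))
  have hgc := hgoodcard j
  rw [le_div_iff₀ hN] at hθj
  have hj4' : ((ψ (φ j) : ℝ) - M (ψ (φ j))) * (1 + (6 * R + 1) ^ 3) < θ / 2 * ψ (φ j) := by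
    rw [div_mul_eq_mul_div, div_lt_iff₀ hN] at hj4
    linarith
  have hθM : θ / 4 * (M (ψ (φ j)) : ℝ) ≤ θ / 4 * ψ (φ j) :=
    mul_le_mul_of_nonneg_left hMleN (by linarith)
  have hbad_y : (badCount (hcpPeriodicConfiguration ha₀ hh₀) R ε (y (ψ (φ j))) : ℝ) ≤
      θ / 4 * (M (ψ (φ j)) : ℝ) := by
    have : (1 - θ / 4) * (M (ψ (φ j)) : ℝ) ≤
        Nat.card {i : Fin (M (ψ (φ j))) // Good (hcpPeriodicConfiguration ha₀ hh₀) R ε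
          (y (ψ (φ j))) i} := hj3.trans hgc
    linarith
  nlinarith

/-- **The Palm reduction of the crux, kernel-checked: `PalmRigidity (9224) ∧ HcpOptimalCongruent ⇒
SlackRigidity`.**  `PalmRigidity` is the route decl of `PalmUnimodularRigidity` BY NAME (item
stmt-AtomisticToContinuum-9224, open: this theorem is CONDITIONAL on it); `HcpOptimalCongruent` is spelled
out.  The witness is `hcpPeriodicConfiguration a₀ h₀` for optimal box parameters, which exist by
`exists_optimal_of_palmRigidity`; the rest is `rigidFor_hcp_of_optimal`. [folklore] -/
theorem slackRigidity_of_palmRigidity_of_hcpOptimalCongruent' (hPalm : PalmRigidity)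
    (hUniq : (∀ (a h a' h' : ℝ) (ha : a ≠ 0) (hh : h ≠ 0) (ha' : a' ≠ 0) (hh' : h' ≠ 0),
      1 / 2 ≤ a → a ≤ 2 → 1 / 2 ≤ h → h ≤ 2 → 1 / 2 ≤ a' → a' ≤ 2 → 1 / 2 ≤ h' → h' ≤ 2 →
      (∀ (b k : ℝ) (hb : b ≠ 0) (hk : k ≠ 0), 1 / 2 ≤ b → b ≤ 2 → 1 / 2 ≤ k → k ≤ 2 →
        (hcpPeriodicConfiguration ha hh).energyPerParticle lennardJones ≤
          (hcpPeriodicConfiguration hb hk).energyPerParticle lennardJones) →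
      (∀ (b k : ℝ) (hb : b ≠ 0) (hk : k ≠ 0), 1 / 2 ≤ b → b ≤ 2 → 1 / 2 ≤ k → k ≤ 2 →
        (hcpPeriodicConfiguration ha' hh').energyPerParticle lennardJones ≤
          (hcpPeriodicConfiguration hb hk).energyPerParticle lennardJones) →
      ∃ B : E3 →ₗᵢ[ℝ] E3, hcpStacking a' h' = B '' hcpStacking a h)) :
    SlackRigidity := by
  rw [slackRigidity_iff]
  obtain ⟨a₀, h₀, ha₀, hh₀, h1, h2, h3, h4, hopt⟩ := exists_optimal_of_palmRigidity hPalm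
  exact ⟨hcpPeriodicConfiguration ha₀ hh₀,
    rigidFor_hcp_of_optimal hPalm hUniq ha₀ hh₀ ⟨h1, h2, h3, h4⟩ hopt⟩

/-- **Registered sub-goal `slackRigidity_of_palmRigidity_of_hcpOptimalCongruent`
(stmt-AtomisticToContinuum-11960, line `ekeland-surgery-parity`): the PALM REDUCTION of the crux —
`PalmRigidity` (route decl of `PalmUnimodularRigidity`, item 9224, by name) and the statement of the
registered stub `stub_hcpOptimalCongruent` imply `SlackRigidity`.** [folklore] -/
theorem slackRigidity_of_palmRigidity_of_hcpOptimalCongruent :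
    PalmRigidity →
    ((∀ (a h a' h' : ℝ) (ha : a ≠ 0) (hh : h ≠ 0) (ha' : a' ≠ 0) (hh' : h' ≠ 0),
      1 / 2 ≤ a → a ≤ 2 → 1 / 2 ≤ h → h ≤ 2 → 1 / 2 ≤ a' → a' ≤ 2 → 1 / 2 ≤ h' → h' ≤ 2 →
      (∀ (b k : ℝ) (hb : b ≠ 0) (hk : k ≠ 0), 1 / 2 ≤ b → b ≤ 2 → 1 / 2 ≤ k → k ≤ 2 →
        (hcpPeriodicConfiguration ha hh).energyPerParticle lennardJones ≤
          (hcpPeriodicConfiguration hb hk).energyPerParticle lennardJones) →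
      (∀ (b k : ℝ) (hb : b ≠ 0) (hk : k ≠ 0), 1 / 2 ≤ b → b ≤ 2 → 1 / 2 ≤ k → k ≤ 2 →
        (hcpPeriodicConfiguration ha' hh').energyPerParticle lennardJones ≤
          (hcpPeriodicConfiguration hb hk).energyPerParticle lennardJones) →
      ∃ B : E3 →ₗᵢ[ℝ] E3, hcpStacking a' h' = B '' hcpStacking a h)) →
    SlackRigidity :=
  fun hPalm hUniq => slackRigidity_of_palmRigidity_of_hcpOptimalCongruent' hPalm hUniq

end Summit.AtomisticToContinuum.Crystallization.Theorems.EkelandSurgeryParityReduction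

end
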